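import Summits.QuantumFields.YangMills.Theorems.PoincareLipschitzLatticeToContinuumLatticeLetters
import Summits.QuantumFields.YangMills.Theorems.PoincareLipschitzLatticeToContinuumCellLetters
import HarnessLib

/-!
# LINE 25 «CompactnessTransfer» (K2 crux `BlockLipschitzL` stmt-QuantumFields-23533 ∕ crux of record `HistoryTailL` stmt-QuantumFields-19936), S2♭″ (Γ-KNIT) —
# FILE (C) «THE CORE STEP AT ONE LEVEL»: Luckhaus' comparison on ℤ³ at a single scale `R` — the almost-minimiser `u` on `Q_R(z)`, a unit recovery map `v`
# (sampled competitor) with `R⁻¹E_v(Q_{⌊s₂R⌋}(0)) ≤ B₂`, the `L²`-closeness of both blow-downs to maps `U = V` on a control set `A` containing the cells of the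
# gluing shell `Q_{a+N(h+1)}(z) ∖ Q_a(z)`; conclusion
# `E_u(Q_a(z)) ≤ R·B₂ + C·(N⁻¹·(Λ₀R + R·B₂) + h⁻²·3·R³·2(e + e′)) + δ·(a + N(h+1))` — ✓(L) `exists_glued_competitor_le` fed with ✓(M)'s counts.

Cell `ym3-torus` (YM ladder rung R3 = continuum SU(2) Yang–Mills on T³ — a RUNG, NOT the Clay problem: not d = 4, not infinite volume, not a mass gap);
width seat `ym3-torus-px3` gen 8 (the Γ-KNIT pen, LEAD ★w1-19936 g10 12:29:32Z S2♭″ ARCHITECTURE v0).  THEOREMS ONLY (0 `def`, 0 `sorry`, default heartbeats);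
`--supports stmt-QuantumFields-23533 --as helper`.
HONEST SCOPE.  One brick of the knit; S2♭″, S1″, `hHalvingBand`, K1, `MeanDeviationL`, `BlockLipschitzL`, `HistoryTailL` are NOT proved here; YM gap NOT proved.

References: S. Luckhaus, Indiana Univ. Math. J. 37 (1988) 349–367, Lemma 1 + proof of Thm 2 [Luckhaus1988]; L. Simon, Theorems on Regularity and
Singularity of Energy Minimizing Maps (1996) §2.9 Lemma 1 [Simon1996].
-/

set_option autoImplicit false

noncomputable section

open scoped BigOperators
open MeasureTheory Set Finset

namespace Summit.QuantumFields.YangMills.Theorems.PoincareLipschitzLatticeToContinuumCoreStep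

open Literature.MathematicalPhysics.QuantumFieldTheory.Balaban1983to89
open B4Eq19LatticeOperators (Zd box unitVec mem_box box_mono)
open Summit.QuantumFields.YangMills.Theorems.PoincareLipschitzLatticeToContinuumLatticeLetters
open Summit.QuantumFields.YangMills.Theorems.PoincareLipschitzLatticeToContinuumCellLetters

/-- ★★★ **THE CORE STEP AT ONE LEVEL.**  Let `C ≥ 0` satisfy the conclusion of ✓`exists_glued_competitor_le`.  Let `u` be a unit lattice map, `δ`-almost-minimising in
every sub-box of `Q_R(z)` (S2♭″'s clause) with `E_u(Q_R(z)) ≤ Λ₀R`; `v` a unit lattice map with `R⁻¹·E_v(Q_{⌊s₂R⌋}(0)) ≤ B₂`, `s₂ ≤ 1`; `U, V` maps agreeing on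
a measurable finite-volume set `A` on which `∫_A ‖u(z+⌊Rx⌋) − U‖² ≤ e` and `∫_A ‖v(⌊Rx⌋) − V‖² ≤ e′`; and `a, h, N` with `1 ≤ h`, `0 < N`, `a + N(h+1) + 1 ≤ s₂R`,
such that the cell `{⌊Rx⌋ = y − z}` of every `y ∈ Q_{a+N(h+1)}(z) ∖ Q_a(z)` lies in `A`.  Then
`E_u(Q_a(z)) ≤ R·B₂ + C·(N⁻¹·(Λ₀R + R·B₂) + (h⁻¹)²·(3·(R³·(2(e + e′))))) + δ·(a + N(h+1))`. [cite: Luckhaus1988, Lemma 1; Simon1996, §2.9 Lemma 1] -/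
theorem core_step {C : ℝ} (hC0 : 0 ≤ C)
    (hC : ∀ (u v : Zd 3 → EuclideanSpace ℝ (Fin 4)) (Z z : Zd 3) (R : ℤ) (δ : ℝ),
      (∀ y, ‖u y‖ = 1) → (∀ y, ‖v y‖ = 1) → 0 ≤ δ →
      (∀ (z' : Zd 3) (ρ : ℤ), 0 ≤ ρ → box z' (ρ + 1) ⊆ box Z R →
        ∀ w : Zd 3 → EuclideanSpace ℝ (Fin 4), (∀ y, y ∉ box z' ρ → w y = u y) → (∀ y ∈ box z' ρ, ‖w y‖ = 1) →
        ∑ y ∈ box z' (ρ + 1), ∑ μ : Fin 3, ‖u (y + unitVec μ) - u y‖ ^ 2 ≤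
        (∑ y ∈ box z' (ρ + 1), ∑ μ : Fin 3, ‖w (y + unitVec μ) - w y‖ ^ 2) + δ * ((ρ : ℝ) + 1)) →
      ∀ (a h N : ℕ), 1 ≤ h → 0 < N → box z ((a : ℤ) + N * (h + 1)) ⊆ box Z R →
      ∃ ρ₁ : ℕ, a + (h + 1) ≤ ρ₁ ∧ ρ₁ ≤ a + N * (h + 1) ∧
        ∑ y ∈ box z (ρ₁ : ℤ), ∑ μ : Fin 3, ‖u (y + unitVec μ) - u y‖ ^ 2 ≤
          (∑ y ∈ box z ((ρ₁ : ℤ) - h - 1), ∑ μ : Fin 3, ‖v (y + unitVec μ) - v y‖ ^ 2) +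
          C * ((N : ℝ)⁻¹ * (∑ y ∈ box z ((a : ℤ) + N * (h + 1)), ∑ μ : Fin 3,
                  (‖u (y + unitVec μ) - u y‖ ^ 2 + ‖v (y + unitVec μ) - v y‖ ^ 2)) +
               ((h : ℝ)⁻¹) ^ 2 * (3 * ∑ y ∈ box z ((a : ℤ) + N * (h + 1)) \ box z (a : ℤ), ‖u y - v y‖ ^ 2)) +
          δ * ρ₁)
    (u v : Zd 3 → EuclideanSpace ℝ (Fin 4)) (hu : ∀ y, ‖u y‖ = 1) (hv : ∀ y, ‖v y‖ = 1) (z : Zd 3) {R : ℤ} (hR : 0 < R)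
    {δ : ℝ} (hδ : 0 ≤ δ)
    (hmin : ∀ (z' : Zd 3) (ρ : ℤ), 0 ≤ ρ → box z' (ρ + 1) ⊆ box z R →
        ∀ w : Zd 3 → EuclideanSpace ℝ (Fin 4), (∀ y, y ∉ box z' ρ → w y = u y) → (∀ y ∈ box z' ρ, ‖w y‖ = 1) →
        ∑ y ∈ box z' (ρ + 1), ∑ μ : Fin 3, ‖u (y + unitVec μ) - u y‖ ^ 2 ≤
        (∑ y ∈ box z' (ρ + 1), ∑ μ : Fin 3, ‖w (y + unitVec μ) - w y‖ ^ 2) + δ * ((ρ : ℝ) + 1))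
    {Λ₀ : ℝ} (hE : ∑ y ∈ box z R, ∑ μ : Fin 3, ‖u (y + unitVec μ) - u y‖ ^ 2 ≤ Λ₀ * R)
    {s₂ B₂ : ℝ} (hs₂ : s₂ ≤ 1)
    (hvE : (R : ℝ)⁻¹ * ∑ y ∈ box (0 : Zd 3) ⌊s₂ * (R : ℝ)⌋, ∑ μ : Fin 3, ‖v (y + unitVec μ) - v y‖ ^ 2 ≤ B₂)
    (U V : EuclideanSpace ℝ (Fin 3) → EuclideanSpace ℝ (Fin 4)) {A : Set (EuclideanSpace ℝ (Fin 3))} (hA : MeasurableSet A) (hAfin : volume A < ⊤)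
    (hUV : ∀ x ∈ A, U x = V x) {e e' : ℝ}
    (hintU : IntegrableOn (fun x => ‖u (z + fun i => ⌊(R : ℝ) * x i⌋) - U x‖ ^ 2) A volume)
    (hintV : IntegrableOn (fun x => ‖v (fun i => ⌊(R : ℝ) * x i⌋) - V x‖ ^ 2) A volume)
    (heU : ∫ x in A, ‖u (z + fun i => ⌊(R : ℝ) * x i⌋) - U x‖ ^ 2 ≤ e)
    (heV : ∫ x in A, ‖v (fun i => ⌊(R : ℝ) * x i⌋) - V x‖ ^ 2 ≤ e')
    (a h N : ℕ) (h1 : 1 ≤ h) (hN : 0 < N) (htop : ((a + N * (h + 1) : ℕ) : ℝ) + 1 ≤ s₂ * R)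
    (hcells : ∀ y ∈ box z ((a : ℤ) + N * (h + 1)) \ box z (a : ℤ), {x : EuclideanSpace ℝ (Fin 3) | ∀ i, ⌊(R : ℝ) * x i⌋ = y i - z i} ⊆ A) :
    ∑ y ∈ box z (a : ℤ), ∑ μ : Fin 3, ‖u (y + unitVec μ) - u y‖ ^ 2 ≤
      (R : ℝ) * B₂ + C * ((N : ℝ)⁻¹ * (Λ₀ * R + R * B₂) + ((h : ℝ)⁻¹) ^ 2 * (3 * ((R : ℝ) ^ 3 * (2 * (e + e'))))) +
        δ * ((a : ℝ) + N * (h + 1)) := by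
  have hR' : (0 : ℝ) < R := by exact_mod_cast hR
  -- the top of the shell is below `⌊s₂R⌋ ≤ R`
  have htopZ : (a : ℤ) + N * (h + 1) ≤ ⌊s₂ * (R : ℝ)⌋ := by
    rw [Int.le_floor]; push_cast at htop ⊢; linarith
  have hfloorR : ⌊s₂ * (R : ℝ)⌋ ≤ R := by
    have : s₂ * (R : ℝ) ≤ R := by nlinarith
    exact Int.floor_le_iff.2 (by linarith)
  have hsub : box z ((a : ℤ) + N * (h + 1)) ⊆ box z R := box_mono z (htopZ.trans hfloorR)
  -- the translated recovery map
  set vz : Zd 3 → EuclideanSpace ℝ (Fin 4) := fun y => v (y - z) with hvz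
  have hvz1 : ∀ y, ‖vz y‖ = 1 := fun y => hv _
  obtain ⟨ρ₁, hρlo, hρhi, hρ⟩ := hC u vz z z R δ hu hvz1 hδ hmin a h N h1 hN hsub
  -- (1) `E_u(Q_a) ≤ E_u(Q_{ρ₁})`
  have hnonneg_u : ∀ y, 0 ≤ ∑ μ : Fin 3, ‖u (y + unitVec μ) - u y‖ ^ 2 := fun y => Finset.sum_nonneg fun μ _ => by positivity
  have hnonneg_v : ∀ y, 0 ≤ ∑ μ : Fin 3, ‖vz (y + unitVec μ) - vz y‖ ^ 2 := fun y => Finset.sum_nonneg fun μ _ => by positivity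
  have h1' : ∑ y ∈ box z (a : ℤ), ∑ μ : Fin 3, ‖u (y + unitVec μ) - u y‖ ^ 2 ≤ ∑ y ∈ box z (ρ₁ : ℤ), ∑ μ : Fin 3, ‖u (y + unitVec μ) - u y‖ ^ 2 :=
    sum_box_le_sum_box hnonneg_u z (by exact_mod_cast (by omega : a ≤ ρ₁))
  -- (2) `E_vz(Q_{ρ₁−h−1}) ≤ E_vz(Q_{⌊s₂R⌋}) = E_v(Q_{⌊s₂R⌋}(0)) ≤ R·B₂`
  have hEv : ∑ y ∈ box z ⌊s₂ * (R : ℝ)⌋, ∑ μ : Fin 3, ‖vz (y + unitVec μ) - vz y‖ ^ 2 ≤ R * B₂ := by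
    have heq : ∑ y ∈ box z ⌊s₂ * (R : ℝ)⌋, ∑ μ : Fin 3, ‖vz (y + unitVec μ) - vz y‖ ^ 2
        = ∑ y ∈ box (0 : Zd 3) ⌊s₂ * (R : ℝ)⌋, ∑ μ : Fin 3, ‖v (y + unitVec μ) - v y‖ ^ 2 := by
      rw [← energy_translate v z]
    rw [heq]
    have := mul_le_mul_of_nonneg_left hvE hR'.le
    rwa [← mul_assoc, mul_inv_cancel₀ hR'.ne', one_mul] at this
  have h2' : ∑ y ∈ box z ((ρ₁ : ℤ) - h - 1), ∑ μ : Fin 3, ‖vz (y + unitVec μ) - vz y‖ ^ 2 ≤ R * B₂ := by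
    refine (sum_box_le_sum_box hnonneg_v z ?_).trans hEv
    have : (ρ₁ : ℤ) ≤ (a : ℤ) + N * (h + 1) := by exact_mod_cast hρhi
    linarith [htopZ, (Nat.cast_nonneg h : (0:ℤ) ≤ h)]
  -- (3) the shell energies `≤ Λ₀R + R·B₂`
  have h3' : ∑ y ∈ box z ((a : ℤ) + N * (h + 1)), ∑ μ : Fin 3, (‖u (y + unitVec μ) - u y‖ ^ 2 + ‖vz (y + unitVec μ) - vz y‖ ^ 2)
      ≤ Λ₀ * R + R * B₂ := by
    rw [Finset.sum_congr rfl fun y _ => Finset.sum_add_distrib, Finset.sum_add_distrib]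
    exact add_le_add ((sum_box_le_sum_box hnonneg_u z (htopZ.trans hfloorR)).trans hE) ((sum_box_le_sum_box hnonneg_v z htopZ).trans hEv)
  -- (4) the `L²` mismatch `≤ R³·2(e + e')`
  have h4' : ∑ y ∈ box z ((a : ℤ) + N * (h + 1)) \ box z (a : ℤ), ‖u y - vz y‖ ^ 2 ≤ (R : ℝ) ^ 3 * (2 * (e + e')) := by
    have hb : ∃ B : ℝ, ∀ y, ‖u y - v (y - z)‖ ^ 2 ≤ B :=
      ⟨4, fun y => by
        have : ‖u y - v (y - z)‖ ≤ 2 := (norm_sub_le _ _).trans (by rw [hu, hv]; norm_num)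
        nlinarith [norm_nonneg (u y - v (y - z))]⟩
    have hm := mismatch_sum_le u v hR' (box z ((a : ℤ) + N * (h + 1)) \ box z (a : ℤ)) z hA hAfin hcells U V hUV hintU hintV hb
    have hR3 : (0 : ℝ) < (R : ℝ) ^ 3 := by positivity
    have := mul_le_mul_of_nonneg_left (hm.trans (by linarith [heU, heV] : 2 * ((∫ x in A, ‖u (z + fun i => ⌊(R : ℝ) * x i⌋) - U x‖ ^ 2) +
      ∫ x in A, ‖v (fun i => ⌊(R : ℝ) * x i⌋) - V x‖ ^ 2) ≤ 2 * (e + e'))) hR3.le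
    rwa [← mul_assoc, ← mul_pow, mul_inv_cancel₀ hR'.ne', one_pow, one_mul] at this
  -- (5) the slack
  have h5' : δ * (ρ₁ : ℝ) ≤ δ * ((a : ℝ) + N * (h + 1)) := mul_le_mul_of_nonneg_left (by exact_mod_cast hρhi) hδ
  -- combine
  have hNinv : (0 : ℝ) ≤ (N : ℝ)⁻¹ := by positivity
  have hhinv : (0 : ℝ) ≤ ((h : ℝ)⁻¹) ^ 2 := by positivity
  have key : C * ((N : ℝ)⁻¹ * (∑ y ∈ box z ((a : ℤ) + N * (h + 1)), ∑ μ : Fin 3,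
        (‖u (y + unitVec μ) - u y‖ ^ 2 + ‖vz (y + unitVec μ) - vz y‖ ^ 2)) +
      ((h : ℝ)⁻¹) ^ 2 * (3 * ∑ y ∈ box z ((a : ℤ) + N * (h + 1)) \ box z (a : ℤ), ‖u y - vz y‖ ^ 2))
      ≤ C * ((N : ℝ)⁻¹ * (Λ₀ * R + R * B₂) + ((h : ℝ)⁻¹) ^ 2 * (3 * ((R : ℝ) ^ 3 * (2 * (e + e'))))) := by
    refine mul_le_mul_of_nonneg_left (add_le_add (mul_le_mul_of_nonneg_left h3' hNinv)
      (mul_le_mul_of_nonneg_left (mul_le_mul_of_nonneg_left h4' (by norm_num)) hhinv)) hC0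
  linarith [hρ, h1', h2', key, h5']

end Summit.QuantumFields.YangMills.Theorems.PoincareLipschitzLatticeToContinuumCoreStep

end
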